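import Literature.NumberTheory.Sieve.BombieriFriedlanderIwaniecSiegelWalfisz
import Literature.NumberTheory.Sieve.PolymathGEHPiecesPrimes
import HarnessLib

/-!
# Bombieri–Vinogradov for the `Ω`-cells of the rough integers, III a: tools for the prime variable

Topic `Literature/NumberTheory/Sieve`, sub-namespace `RoughCellsAP`.  Everything here is PROVED:
bookkeeping used to verify hypothesis (A₂) of Bombieri–Friedlander–Iwaniec (Acta Math. 156 (1986),
§1 p. 206) for a box of primes `β = 1_{primes in (m, m']}` inside a dyadic range `(N, 2N]`
(companion file `RoughOmegaCellsClassesBVPrimes.lean`):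

* `apDiscrepancy_primePiece_eq` — Polymath's discrepancy `Δ(β 1_{(·,d)=1}; 4m; a (k))`
  (`apDiscrepancy`, cut-off `4m`) equals BFI's
  `Σ_{v∼N, v≡a (k), (v,d)=1} β_v − φ(k)⁻¹ Σ_{v∼N, (v,dk)=1} β_v`;
* `small_moduli_bookkeeping`, `disc_le_large_moduli` — the absolute bounds for moduli
  `k ≤ (log 2N)^{4A}` (from the Siegel–Walfisz input) and `k > (log 2N)^{4A}` (trivial bound
  `BFI.abs_disc_le_large` with `1/φ(k) ≤ τ(k)/k ≤ C_τ k^{-1/2}`);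
* `div_rpow_le_sqrt_mul`, `two_mul_le_sqrt_mul` — conversion of absolute into relative
  (`‖β‖ N^{1/2}`) bounds for dense resp. arbitrary `{0,1}`-valued `β`;
* `rpow_two_mul_le_of_scale`, `exists_threshold_log` — scale inequalities.

## References

* E. Bombieri, J. B. Friedlander, H. Iwaniec, Acta Math. 156 (1986), 203–251, §1 (A₂) p. 206.
  [BombieriFriedlanderIwaniecActa1986]
* D. H. J. Polymath, Res. Math. Sci. 1:12 (2014), Claim 2.6. [Polymath8b2014]
-/

open Finset Real Filter
open scoped ArithmeticFunction.sigma

namespace Literature.NumberTheory.Sieve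

namespace RoughCellsAP

open BFI

/-! ### Small real-variable lemmas -/

/-- `L^{2A} = (L^A)²` for `L ≥ 0`. [folklore] -/
theorem rpow_two_mul_eq_sq {L : ℝ} (hL : 0 ≤ L) (A : ℝ) : L ^ (2 * A) = (L ^ A) ^ 2 := by
  rw [mul_comm, Real.rpow_mul hL, Real.rpow_two]

/-- Density converts absolute into relative bounds: if `N/L^{2A} < Z` then
`N/L^{2A} ≤ √Z · N^{1/2}/L^A`. [folklore] -/
theorem div_rpow_le_sqrt_mul {N L Z A : ℝ} (hN : 0 ≤ N) (hL : 0 < L) (hZ : N / L ^ (2 * A) < Z) :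
    N / L ^ (2 * A) ≤ Real.sqrt Z * N ^ (1 / 2 : ℝ) / L ^ A := by
  have hLA : 0 < L ^ A := Real.rpow_pos_of_pos hL A
  set u : ℝ := N ^ (1 / 2 : ℝ) / L ^ A with hu
  have hu0 : 0 ≤ u := by positivity
  have hu2 : u ^ 2 = N / L ^ (2 * A) := by
    rw [hu, div_pow, ← rpow_two_mul_eq_sq hL.le, ← Real.sqrt_eq_rpow, Real.sq_sqrt hN]
  have huZ : u ≤ Real.sqrt Z := by
    refine (Real.lt_sqrt hu0).2 ?_ |>.le
    rw [hu2]; exact hZ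
  calc N / L ^ (2 * A) = u * u := by rw [← hu2, sq]
    _ ≤ Real.sqrt Z * u := mul_le_mul_of_nonneg_right huZ hu0
    _ = Real.sqrt Z * N ^ (1 / 2 : ℝ) / L ^ A := by rw [hu, mul_div_assoc]

/-- The trivial bound in relative form: `Z ≤ 3N` gives `2Z ≤ 4 √Z N^{1/2}`. [folklore] -/
theorem two_mul_le_sqrt_mul {N Z : ℝ} (hZ0 : 0 ≤ Z) (hZ : Z ≤ 3 * N) :
    2 * Z ≤ 4 * Real.sqrt Z * N ^ (1 / 2 : ℝ) := by
  rw [← Real.sqrt_eq_rpow]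
  have h1 : Real.sqrt Z ≤ Real.sqrt (3 * N) := Real.sqrt_le_sqrt hZ
  have h2 : Real.sqrt (3 * N) ≤ 2 * Real.sqrt N := by
    rw [Real.sqrt_mul (by norm_num)]
    refine mul_le_mul_of_nonneg_right ?_ (Real.sqrt_nonneg _)
    rw [Real.sqrt_le_left (by norm_num)]; norm_num
  have h3 : Z = Real.sqrt Z * Real.sqrt Z := (Real.mul_self_sqrt hZ0).symm
  have h4 : 0 ≤ Real.sqrt Z := Real.sqrt_nonneg Z
  nlinarith [mul_le_mul_of_nonneg_left (h1.trans h2) h4]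

/-! ### The values of a prime piece -/

/-- `primePiece m m' v ∈ {0, 1}`. [folklore] -/
theorem primePiece_eq_zero_or_one (m m' v : ℕ) : primePiece m m' v = 0 ∨ primePiece m m' v = 1 := by
  rw [primePiece_apply]; split_ifs <;> simp

/-- The support of a prime piece. [folklore] -/
theorem primePiece_ne_zero_iff {m m' v : ℕ} : primePiece m m' v ≠ 0 ↔ m < v ∧ v ≤ m' ∧ v.Prime := by
  rw [primePiece_apply]; split_ifs with h <;> simp [h]

/-- `‖β‖² = Σ_{v ∼ N} β_v` for a `{0,1}`-valued `β`. [folklore] -/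
theorem l2Sq_primePiece_eq (N : ℝ) (m m' : ℕ) :
    l2Sq N ⇑(primePiece m m') = ∑ v ∈ dyadic N, primePiece m m' v := by
  unfold l2Sq
  refine Finset.sum_congr rfl fun v _ => ?_
  rcases primePiece_eq_zero_or_one m m' v with h | h <;> simp [h]

/-! ### The discrepancy of a prime piece: Polymath's form and BFI's form -/

/-- For a prime piece supported in `(N, 2N]` (`N < m + 1`, `m' ≤ 2N`), Polymath's discrepancy
`Δ(β 1_{(·,d)=1}; 4m; a (k))` is BFI's `Σ_{v∼N, v≡a, (v,d)=1} β − φ(k)⁻¹ Σ_{v∼N, (v,dk)=1} β`. [folklore] -/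
theorem apDiscrepancy_primePiece_eq {N : ℝ} (hN : 0 ≤ N) {m m' : ℕ} (hm : N < (m : ℝ) + 1)
    (hm' : (m' : ℝ) ≤ 2 * N) (d k : ℕ) (a : (ZMod k)ˣ) :
    apDiscrepancy (fun v => if v.Coprime d then primePiece m m' v else 0) (4 * m) k a =
      (∑ v ∈ (dyadic N).filter (fun v : ℕ => (v : ZMod k) = (a : ZMod k) ∧ v.Coprime d), primePiece m m' v) -
        (∑ v ∈ (dyadic N).filter (fun v : ℕ => v.Coprime (d * k)), primePiece m m' v) /
          (Nat.totient k : ℝ) := by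
  have hsupp : ∀ v : ℕ, primePiece m m' v ≠ 0 → (v ∈ dyadic N ↔ v ∈ Finset.Icc 1 (4 * m)) := by
    intro v hv
    obtain ⟨h1, h2, hp⟩ := primePiece_ne_zero_iff.1 hv
    have hv2 := hp.two_le
    have h2r : (v : ℝ) ≤ m' := by exact_mod_cast h2
    have hvr : (v : ℝ) < 2 * m + 2 := by linarith
    have hvn : v < 2 * m + 2 := by exact_mod_cast hvr
    have hv1 : (m : ℝ) + 1 ≤ v := by exact_mod_cast h1
    rw [mem_dyadic hN, Finset.mem_Icc]
    constructor
    · intro _; exact ⟨by omega, by omega⟩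
    · intro _; exact ⟨by linarith, by linarith⟩
  have hzero : ∀ v : ℕ, ∀ (P : Prop) [Decidable P], (if P then primePiece m m' v else 0) ≠ 0 →
      primePiece m m' v ≠ 0 := by
    intro v P _ h h0; apply h; rw [h0, ite_self]
  unfold apDiscrepancy
  rw [Finset.sum_filter, Finset.sum_filter, Finset.sum_filter, Finset.sum_filter]
  congr 1
  · rw [sum_eq_sum_of_support (s := dyadic N) (t := Finset.Icc 1 (4 * m))
      (fun v hv => hsupp v (hzero v _ hv))]
    refine Finset.sum_congr rfl fun v _ => ?_
    by_cases h1 : (v : ZMod k) = (a : ZMod k)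
    · by_cases h2 : v.Coprime d
      · rw [if_pos h1, if_pos h2, if_pos ⟨h1, h2⟩]
      · rw [if_pos h1, if_neg h2, if_neg (fun h => h2 h.2)]
    · rw [if_neg h1, if_neg (fun h => h1 h.1)]
  · congr 1
    rw [sum_eq_sum_of_support (s := dyadic N) (t := Finset.Icc 1 (4 * m))
      (fun v hv => hsupp v (hzero v _ hv))]
    refine Finset.sum_congr rfl fun v _ => ?_
    have hiff : v.Coprime (d * k) ↔ v.Coprime d ∧ v.Coprime k := Nat.coprime_mul_iff_right
    by_cases h1 : v.Coprime k
    · by_cases h2 : v.Coprime d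
      · rw [if_pos h1, if_pos h2, if_pos (hiff.2 ⟨h2, h1⟩)]
      · rw [if_pos h1, if_neg h2, if_neg (fun h => h2 (hiff.1 h).1)]
    · rw [if_neg h1, if_neg (fun h => h1 (hiff.1 h).2)]

/-- Bookkeeping for the small moduli: from `D ≤ C_P τ(kd) m (log 2X)^{-6A}` with `τ(kd) ≤ τ(k) τ(d)`,
`τ(k) ≤ L^{4A}`, `m ≤ 2N` and `L ≤ log 2X` one gets `D ≤ 2 max(C_P, 0) τ(d) N L^{-2A}`. [folklore] -/
theorem small_moduli_bookkeeping {D CP τkd τk τd m N L LX A : ℝ} (hA : 0 < A) (hL : 0 < L) (hLX : L ≤ LX)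
    (hP : D ≤ CP * τkd * m / LX ^ (6 * A)) (hτ : τkd ≤ τk * τd) (hτk : τk ≤ L ^ (4 * A))
    (hτkd0 : 0 ≤ τkd) (hτd : 0 ≤ τd) (hm : m ≤ 2 * N) (hm0 : 0 ≤ m) :
    D ≤ 2 * max CP 0 * τd * (N / L ^ (2 * A)) := by
  have hL6 : 0 < L ^ (6 * A) := Real.rpow_pos_of_pos hL _
  have hLX6 : L ^ (6 * A) ≤ LX ^ (6 * A) := Real.rpow_le_rpow hL.le hLX (by positivity)
  have hCP0 : 0 ≤ max CP 0 := le_max_right _ _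
  have hN : 0 ≤ N := by linarith
  calc D ≤ CP * τkd * m / LX ^ (6 * A) := hP
    _ ≤ max CP 0 * τkd * m / LX ^ (6 * A) := by
        refine div_le_div_of_nonneg_right ?_ (hL6.le.trans hLX6)
        exact mul_le_mul_of_nonneg_right (mul_le_mul_of_nonneg_right (le_max_left _ _) hτkd0) hm0
    _ ≤ max CP 0 * (L ^ (4 * A) * τd) * (2 * N) / L ^ (6 * A) := by
        refine div_le_div₀ (by positivity) ?_ hL6 hLX6
        have : τkd ≤ L ^ (4 * A) * τd := hτ.trans (mul_le_mul_of_nonneg_right hτk hτd)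
        gcongr
    _ = 2 * max CP 0 * τd * (N / L ^ (2 * A)) := by
        have : L ^ (6 * A) = L ^ (4 * A) * L ^ (2 * A) := by
          rw [← Real.rpow_add hL]; ring_nf
        rw [this]
        have h4 : 0 < L ^ (4 * A) := Real.rpow_pos_of_pos hL _
        have h2 : 0 < L ^ (2 * A) := Real.rpow_pos_of_pos hL _
        field_simp

/-- **Large moduli**: for a `{0,1}`-valued `β` on `n ∼ N`, `k > L^{4A}` (`L = log 2N ≥ 1`,
`L^{2A} ≤ N`) and a reduced class, the trivial bound gives `|Δ| ≤ (3 C_τ + 3) N L^{-2A}`, where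
`τ(k) ≤ C_τ k^{1/2}`. [folklore] -/
theorem disc_le_large_moduli {β : ℕ → ℝ} (hβ : ∀ v, β v = 0 ∨ β v = 1) {N A Cτ : ℝ} (hN1 : 1 ≤ N)
    (hL1 : 1 ≤ Real.log (2 * N)) (hL2A : Real.log (2 * N) ^ (2 * A) ≤ N) (hA : 0 < A)
    (hCτ1 : 1 ≤ Cτ) (hCτ : ∀ k : ℕ, (σ 0 k : ℝ) ≤ Cτ * (k : ℝ) ^ (1 / 2 : ℝ))
    {k : ℕ} (hk : 1 ≤ k) (hkL : Real.log (2 * N) ^ (4 * A) < k) {l : ZMod k} (hl : IsUnit l) (d : ℕ) :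
    |(∑ v ∈ (dyadic N).filter (fun v : ℕ => (v : ZMod k) = l ∧ v.Coprime d), β v) -
        (∑ v ∈ (dyadic N).filter (fun v : ℕ => v.Coprime (d * k)), β v) / (Nat.totient k : ℝ)| ≤
      (3 * Cτ + 3) * (N / Real.log (2 * N) ^ (2 * A)) := by
  set L : ℝ := Real.log (2 * N) with hLdef
  have hN0 : 0 < N := by linarith
  have hlog0 : 0 < L := by linarith
  have hk0 : (0 : ℝ) < k := by exact_mod_cast hk
  have hlarge := abs_disc_le_large (β := β) hN0.le zero_le_one
    (fun v _ => by rcases hβ v with h | h <;> simp [h]) hk hl d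
  rw [mul_one] at hlarge
  have hL2A0 : 0 < L ^ (2 * A) := Real.rpow_pos_of_pos hlog0 _
  have hL4 : L ^ (2 * A) ≤ L ^ (4 * A) := Real.rpow_le_rpow_of_exponent_le hL1 (by linarith)
  -- `1/φ(k) ≤ τ(k)/k ≤ Cτ / k^{1/2} ≤ Cτ / L^{2A}`
  have hφ : ((Nat.totient k : ℝ))⁻¹ ≤ Cτ / L ^ (2 * A) := by
    have h1 := inv_totient_le_sigma_zero_div k
    have h2 : (σ 0 k : ℝ) / k ≤ Cτ * (k : ℝ) ^ (1 / 2 : ℝ) / k := div_le_div_of_nonneg_right (hCτ k) hk0.le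
    have h3 : Cτ * (k : ℝ) ^ (1 / 2 : ℝ) / k = Cτ / (k : ℝ) ^ (1 / 2 : ℝ) := by
      have hs : 0 < (k : ℝ) ^ (1 / 2 : ℝ) := Real.rpow_pos_of_pos hk0 _
      have hk' : (k : ℝ) ^ (1 / 2 : ℝ) * (k : ℝ) ^ (1 / 2 : ℝ) = k := by
        rw [← Real.sqrt_eq_rpow, Real.mul_self_sqrt hk0.le]
      rw [div_eq_div_iff hk0.ne' hs.ne', mul_assoc, hk']
    have h4 : L ^ (2 * A) ≤ (k : ℝ) ^ (1 / 2 : ℝ) := by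
      have := Real.rpow_le_rpow (Real.rpow_nonneg hlog0.le _) hkL.le (show (0 : ℝ) ≤ 1 / 2 by norm_num)
      rw [← Real.rpow_mul hlog0.le] at this
      convert this using 2; ring
    calc ((Nat.totient k : ℝ))⁻¹ ≤ Cτ / (k : ℝ) ^ (1 / 2 : ℝ) := by rw [← h3]; exact h1.trans h2
      _ ≤ Cτ / L ^ (2 * A) := div_le_div_of_nonneg_left (by linarith) hL2A0 h4
  have h1 : 2 * N / k ≤ 2 * (N / L ^ (2 * A)) := by
    rw [mul_div_assoc]
    exact mul_le_mul_of_nonneg_left (div_le_div_of_nonneg_left hN0.le hL2A0 (hL4.trans hkL.le)) (by norm_num)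
  have h2 : (1 : ℝ) ≤ N / L ^ (2 * A) := by rw [le_div_iff₀ hL2A0, one_mul]; exact hL2A
  have h3 : (2 * N + 1) / (Nat.totient k : ℝ) ≤ 3 * Cτ * (N / L ^ (2 * A)) := by
    rw [div_eq_mul_inv]
    calc (2 * N + 1) * ((Nat.totient k : ℝ))⁻¹ ≤ (3 * N) * (Cτ / L ^ (2 * A)) :=
          mul_le_mul (by linarith) hφ (inv_nonneg.2 (Nat.cast_nonneg _)) (by linarith)
      _ = 3 * Cτ * (N / L ^ (2 * A)) := by ring
  calc _ ≤ 2 * N / k + 1 + (2 * N + 1) / (Nat.totient k : ℝ) := hlarge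
    _ ≤ 2 * (N / L ^ (2 * A)) + N / L ^ (2 * A) + 3 * Cτ * (N / L ^ (2 * A)) := by linarith
    _ = (3 * Cτ + 3) * (N / L ^ (2 * A)) := by ring

/-- Scales: for `X ≥ 4^{4n}` and `X^{1/(2n)} < m + 1` one has `(2X)^{1/(4n)} ≤ m` and `4 ≤ m`.
[folklore] -/
theorem rpow_two_mul_le_of_scale {n : ℕ} (hn : 0 < n) {X m : ℝ} (hX : (4 : ℝ) ^ (4 * n) ≤ X)
    (hm : X ^ (1 / (2 * (n : ℝ))) < m + 1) : (2 * X) ^ (1 / (4 * (n : ℝ))) ≤ m ∧ 4 ≤ m := by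
  have hn0 : (0 : ℝ) < n := by exact_mod_cast hn
  have hX0 : 0 < X := lt_of_lt_of_le (by positivity) hX
  set t : ℝ := X ^ (1 / (4 * (n : ℝ))) with ht
  have ht4 : 4 ≤ t := by
    have h2 : ((4 : ℝ) ^ (4 * n)) ^ (1 / (4 * (n : ℝ))) ≤ t := Real.rpow_le_rpow (by positivity) hX (by positivity)
    have h3 : ((4 : ℝ) ^ (4 * n)) ^ (1 / (4 * (n : ℝ))) = 4 := by
      rw [← Real.rpow_natCast, ← Real.rpow_mul (by norm_num)]
      push_cast
      rw [show (4 * (n : ℝ)) * (1 / (4 * (n : ℝ))) = 1 by field_simp, Real.rpow_one]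
    linarith
  have ht2 : t ^ 2 = X ^ (1 / (2 * (n : ℝ))) := by
    rw [ht, ← Real.rpow_natCast, ← Real.rpow_mul hX0.le]
    congr 1; push_cast; field_simp; ring
  have h1 : (2 * X) ^ (1 / (4 * (n : ℝ))) ≤ 2 * t := by
    rw [Real.mul_rpow (by norm_num) hX0.le]
    refine mul_le_mul_of_nonneg_right ?_ (by positivity)
    calc (2 : ℝ) ^ (1 / (4 * (n : ℝ))) ≤ 2 ^ (1 : ℝ) := by
          refine Real.rpow_le_rpow_of_exponent_le (by norm_num) ?_
          rw [div_le_one (by positivity)]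
          have : (1 : ℝ) ≤ n := by exact_mod_cast hn
          linarith
      _ = 2 := Real.rpow_one 2
  have h2 : t ^ 2 - 1 < m := by rw [ht2]; linarith
  have h3 : 2 * t ≤ t ^ 2 - 1 := by nlinarith [mul_self_nonneg (t - 4)]
  constructor <;> linarith

/-- A threshold beyond which `log 2N ≥ 1` and `(log 2N)^{2A} ≤ N`. [folklore] -/
theorem exists_threshold_log (A : ℝ) :
    ∃ N₁ : ℝ, 1 ≤ N₁ ∧ ∀ N : ℝ, N₁ ≤ N → 1 ≤ Real.log (2 * N) ∧ Real.log (2 * N) ^ (2 * A) ≤ N := by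
  have h := (isLittleO_log_rpow_rpow_atTop (2 * A) one_pos).bound (show (0 : ℝ) < 1 / 2 by norm_num)
  obtain ⟨y₀, hy₀⟩ := Filter.eventually_atTop.1 h
  refine ⟨max (max y₀ (Real.exp 1)) 1, le_max_right _ _, fun N hN => ?_⟩
  have hN1 : 1 ≤ N := (le_max_right _ _).trans hN
  have hNe : Real.exp 1 ≤ N := le_trans (le_trans (le_max_right _ _) (le_max_left _ _)) hN
  have hNy : y₀ ≤ 2 * N := by
    have := le_trans (le_trans (le_max_left _ _) (le_max_left _ _)) hN
    linarith
  constructor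
  · rw [Real.le_log_iff_exp_le (by linarith)]; linarith
  · have := hy₀ (2 * N) hNy
    rw [Real.norm_of_nonneg (Real.rpow_nonneg (Real.log_nonneg (by linarith)) _), Real.rpow_one,
      Real.norm_of_nonneg (by linarith)] at this
    linarith

end RoughCellsAP

end Literature.NumberTheory.Sieve
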